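import Summits.QuantumFields.BalabanUV.T4Continuum.Support.NE7EnergyBlockLandauPoincare
import Summits.QuantumFields.BalabanUV.T4Continuum.Support.NE3ClassRadiusFamily
import Summits.QuantumFields.BalabanUV.T4Continuum.Support.NE7ConvOneStepSU2
import Summits.QuantumFields.BalabanUV.T4Continuum.Support.NE7SlicePoincareTASU2
import HarnessLib

/-!
# NE7EnergyBlockLandauClassPoincare — THE POINCARÉ INEQUALITY OF THE CORNER-FREE ENERGY BLOCK-LANDAU SLICE `𝒯_E(W)` ON THE WHOLE SU(2) SMALL-FIELD CLASS AT
# `d = 4`, `L = 2`, EVERY LEVEL, EVERY TORUS, NO NUMERIC HYPOTHESIS LEFT: constant `8·CPLine(4,2,2,10⁻¹⁷,10⁻⁵³)`, class radius `0 < ε ≤ 10⁻⁵³`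

Cell `pub-balaban`, rung (B)+1 sub-cell t4, lineage `b2b-balaban-t4-ne7-p1` (CRUX PROVER NE7 #1 = OWNER of row NE7), generation 99; memo
`t4/b2b-balaban-t4-ne7-p1-g99/ROAD-G99.md` §3.2 («coercivity to be DOCKED» — DONE here, by transfer instead of docking).

WHAT ([folklore]; 0 def, 0 sorry).  **`classSlicePoincare_energyBlockLandau_SU2`**: `card n = 2`, `N ≥ 1`, `0 < ε ≤ 10⁻⁵³` ⟹ for every level `j+1` and every `W ∈ sfClass 4 2 N ε (j+1)`:
`SlicePoincare 2 (j+1) W (energyBlockLandauW 2 N (j+1) W) (8·CPLine 4 2 2 10⁻¹⁷ 10⁻⁵³) (periodBox (N·2^{j+1}))` — row NE3-R2's class theorem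
`NE3ClassRadiusFamily.classSlicePoincare_SU2'` (for `T_♮ = frameFreeBlockLandauW`) transferred by gen 99's `NE7EnergyBlockLandauPoincare.slicePoincare_energyBlockLandauW_of_frameFree`,
its two displayed lines discharged in numbers: K6-Ξ's by `NE3ClassSlicePoincare.xi_of_line` + `lines_d4_L2_c2` (θ = 10⁻⁵³), the absorption line `32·2·#Plane·CPLine·ε² ≤ 1∕2` by
`CPLine ≤ 1234·10¹⁴` (`lines_d4_L2_c2`), `#Plane ≤ 16` (`NE7SlicePoincareTASU2.card_plane_four_le`) and `ε ≤ 10⁻⁵³`; the level family by `NE7ConvOneStepSU2.levelSmall_all_d4_L2`.  This is the coercivity input of the END's comparison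
argument (`isMinimiser_of_critical_rep_weighted`) for the Bałaban-slice road, with the same constant family as the T_♮ road (factor 8).
HONEST FRAMING (page 1): arithmetic over kernel theorems of rows NE3∕NE3-R2 and gen 99's transfer; nothing of Bałaban's asserted; NE7 NOT PROVED; spine 0∕9; finite T⁴ rung (B)+1 — NOT infinite
volume, NOT mass gap, NOT `BetaPertH`, NOT Clay.  Continuum YM on T⁴ ⇐ BetaPertH ∧ nine spine estimates (0/9 proved); BetaPertH ⇐ (D1) ∧ (D4) ∧ CAP+tail; G-an2-4 gates asym, D1 and NE2/3/4.
-/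

set_option autoImplicit false

namespace Summit.QuantumFields.BalabanUV.T4Continuum.NE7EnergyBlockLandauClassPoincare

open Literature.MathematicalPhysics.QuantumFieldTheory.Balaban1983to89
open B7Prop1Explicit B7Prop2Explicit
open T4AveragingDeficitWall (IsUnitaryCfg SmallField Plane)
open T4AveragingDeficitWallBoundary (IsPeriodicCfg periodBox)
open AveragingDeficitMultiLevelPrep (LevelSmall tower)
open NE3SlicePoincareBudgetLine (CPLine)
open NE3SlicePoincareShape (SlicePoincare)
open NE3FrameFreeSliceW (frameFreeBlockLandauW)
open NE3ClassSlicePoincare (lines_d4_L2_c2 xi_of_line)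
open NE3ClassRadiusFamily (CPLine_nonneg_d4_L2 classSlicePoincare_SU2')
open NE7ConvOneStepSU2 (levelSmall_all_d4_L2)
open NE7SlicePoincareTASU2 (card_plane_four_le)
open NE7CornerSpikeTopDictionary (natCast_tower_eq_pow_mul)
open NE7MeanZeroGaugeSliceW (energyBlockLandauW)
open NE7EnergyBlockLandauPoincare (slicePoincare_energyBlockLandauW_of_frameFree)
open MinimalActionRate (sfClass)

noncomputable section

variable {n : Type*} [Fintype n] [DecidableEq n]

/-- **SLICE POINCARÉ FOR `𝒯_E(W)` ON THE WHOLE SU(2) CLASS AT `d = 4`, `L = 2`** (every `N ≥ 1`, every `0 < ε ≤ 10⁻⁵³`, every level `j+1`, every `W ∈ sfClass 4 2 N ε (j+1)`):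
`SlicePoincare 2 (j+1) W (energyBlockLandauW 2 N (j+1) W) (8·CPLine 4 2 2 10⁻¹⁷ 10⁻⁵³) (periodBox (N·2^{j+1}))`. [folklore] -/
theorem classSlicePoincare_energyBlockLandau_SU2 [Nonempty n] (hn : Fintype.card n = 2) {N : ℕ} [NeZero N] (hN : 1 ≤ N) {ε : ℝ} (hε : 0 < ε)
    (hε' : ε ≤ 1 / 10 ^ 53) :
    ∀ j : ℕ, ∀ W : Site 4 → Fin 4 → (Matrix n n ℂ)ˣ, W ∈ sfClass 4 2 N ε (j + 1) →
      SlicePoincare 2 (j + 1) W (energyBlockLandauW (d := 4) (n := n) 2 N (j + 1) W) (8 * CPLine 4 2 2 (1 / 10 ^ 17) (1 / 10 ^ 53))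
        (periodBox (d := 4) (N * 2 ^ (j + 1))) := by
  intro j W hW
  obtain ⟨hWu, hWP, hWx⟩ := hW
  have htower : tower 2 N (j + 1) = 2 ^ (j + 1) * N := by exact_mod_cast natCast_tower_eq_pow_mul 2 N (j + 1)
  have hNM : N * 2 ^ (j + 1) = tower 2 N (j + 1) := by rw [htower, Nat.mul_comm]
  -- the class data in the transfer theorem's format
  set x : ℝ := ε / (((2 : ℕ) : ℝ) ^ (j + 1)) ^ 2 with hxdef
  have hx : 0 ≤ x := by rw [hxdef]; positivity
  have hs : LevelSmall 4 2 j x := levelSmall_all_d4_L2 hε.le (hε'.trans (by norm_num)) j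
  have hWP' : IsPeriodicCfg W ((tower 2 N (j + 1) : ℕ) : ℤ) := by rw [← hNM]; exact hWP
  have hMx : (((2 : ℕ) : ℝ) ^ (j + 1)) ^ 2 * x = ε := by
    rw [hxdef]; field_simp
  -- row NE3-R2's class Poincaré on `T_♮`
  have hP := classSlicePoincare_SU2' (n := n) hn hN hε hε' j W ⟨hWu, hWP, hWx⟩
  rw [hNM] at hP
  -- K6-Ξ's line at `θ = 10⁻⁵³`
  obtain ⟨-, -, -, hΞ, hCP⟩ := lines_d4_L2_c2
  have hline : 8 * ((4 : ℕ) : ℝ) * ((((4 : ℕ) : ℝ) - 1) * (1 / 10 ^ 53)) ^ 2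
      + 2 * (((Fintype.card n : ℕ) : ℝ) * ((4 * ((4 : ℕ) : ℝ) ^ 2 + 272 * ((4 : ℕ) : ℝ) * ((((4 : ℕ) : ℝ) + 1) * (((4 : ℕ) : ℝ) + 4))) * (1 / 10 ^ 53)) ^ 2)
        ≤ 1 / 2 := by
    rw [hn]; exact hΞ
  have hK6 := xi_of_line (d := 4) (by norm_num) (L := 2) (c := Fintype.card n) (by norm_num) j hx hs (θ := 1 / 10 ^ 53) (by rw [hMx]; exact hε') hline
  have hcard : (Fintype.card n : ℝ) = ((2 : ℕ) : ℝ) := by rw [hn]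
  -- the absorption line
  have hC0 := CPLine_nonneg_d4_L2
  have hPl := card_plane_four_le
  have hPl0 : (0 : ℝ) ≤ Fintype.card (Plane 4) := Nat.cast_nonneg _
  have habs : 32 * (Fintype.card n : ℝ) * (Fintype.card (Plane 4) : ℝ) * CPLine 4 2 2 (1 / 10 ^ 17) (1 / 10 ^ 53)
      * ((((2 : ℕ) : ℝ) ^ (j + 1)) ^ 2 * x) ^ 2 ≤ 1 / 2 := by
    rw [hMx, hcard]
    have hε2 : ε ^ 2 ≤ (1 / 10 ^ 53) ^ 2 := pow_le_pow_left₀ hε.le hε' 2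
    have hε20 : 0 ≤ ε ^ 2 := sq_nonneg _
    calc 32 * (((2 : ℕ) : ℝ)) * (Fintype.card (Plane 4) : ℝ) * CPLine 4 2 2 (1 / 10 ^ 17) (1 / 10 ^ 53) * ε ^ 2
        ≤ 32 * (((2 : ℕ) : ℝ)) * 16 * (1234 * 10 ^ 14) * (1 / 10 ^ 53) ^ 2 := by
          have h1 : 32 * (((2 : ℕ) : ℝ)) * (Fintype.card (Plane 4) : ℝ) ≤ 32 * (((2 : ℕ) : ℝ)) * 16 := by nlinarith
          have h2 : 32 * (((2 : ℕ) : ℝ)) * (Fintype.card (Plane 4) : ℝ) * CPLine 4 2 2 (1 / 10 ^ 17) (1 / 10 ^ 53)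
              ≤ 32 * (((2 : ℕ) : ℝ)) * 16 * (1234 * 10 ^ 14) :=
            mul_le_mul h1 hCP hC0 (by norm_num)
          exact mul_le_mul h2 hε2 hε20 (by norm_num)
      _ ≤ 1 / 2 := by norm_num
  -- transfer
  have hT := slicePoincare_energyBlockLandauW_of_frameFree (d := 4) (n := n) (N := N) (L := 2) (by norm_num) (by norm_num) j
    hWu hWP' hx hs hWx hK6 hC0 habs hP
  rw [hNM]
  have e8 : 4 * (Fintype.card n : ℝ) * CPLine 4 2 2 (1 / 10 ^ 17) (1 / 10 ^ 53) = 8 * CPLine 4 2 2 (1 / 10 ^ 17) (1 / 10 ^ 53) := by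
    rw [hn]; push_cast; ring
  rw [← e8]
  exact hT

end

end Summit.QuantumFields.BalabanUV.T4Continuum.NE7EnergyBlockLandauClassPoincare
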